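import Mathlib
import HarnessLib

/-!
# Krull dimension of Laurent polynomial rings in `m` variables: `dim R + m ≤ dim R[ℤᵐ]`

Route `ResolutionOfSingularities/WeightedInvariant`, door crux `HypersurfaceCentreConstruction`
(stmt-ResolutionOfSingularities-19897), e-ladder `e = 1` of `res-L1-w43-stub-10` (cell res-hironaka,
`D/res-D-pv-025/E1Skeleton.lean`, stub `stub_e1_inv_succ` «torus bookkeeping L1»).  The dimension count on a
torus chart (`Theorems/WeightedInvariantTorusChartDimension.lean`: an orbit of an `m`-torus acting with finite
stabilisers has dimension `m`, and an `m`-dimensional orbit closure is the orbit) rests on the elementary bound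
proved here for every commutative ring `R` (`R[ℤᵐ] = AddMonoidAlgebra R (Fin m → ℤ)`):

* `laurent_single_sub_one_mem_nonZeroDivisors` — `T_χ - 1` (`χ ≠ 0`) is a non-zero-divisor of `R[ℤᵐ]`;
* `ringKrullDim_laurent_succ_le` — `dim R[ℤᵐ] + 1 ≤ dim R[ℤᵐ⁺¹]` (the substitution `T_last ↦ 1` is surjective
  and kills `T_last - 1`; Mathlib's `ringKrullDim_succ_le_of_surjective`);
* `ringKrullDim_add_le_ringKrullDim_laurent` — `dim R + m ≤ dim R[ℤᵐ]`.

Pure commutative algebra (Mathlib has the polynomial analogue `ringKrullDim_add_natCard_le_ringKrullDim_mvPolynomial`);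
nothing here is a claim about Hironaka's problem.  AI-written; weaker than expert review.
-/

noncomputable section

open scoped nonZeroDivisors

set_option linter.dupNamespace false -- mandated namespace of this single-conjunct summit

namespace Summit.ResolutionOfSingularities.ResolutionOfSingularities.Theorems

/-! ## §1 Laurent polynomial rings in `m` variables: `dim R + m ≤ dim R[ℤᵐ]` -/

section Laurent

variable (R : Type*) [CommRing R]

/-- In the group algebra `R[G]` of a torsion-free-like additive group — here `G = ℤᵐ` — the element `T_χ - 1`
(`χ ≠ 0`) is a non-zero-divisor: if `T_χ · g = g` then the (finite) support of `g` is stable under translation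
by `χ`, along which the linear form `x ↦ ∑ χᵢ xᵢ` strictly increases. [folklore] -/
theorem laurent_single_sub_one_mem_nonZeroDivisors {m : ℕ} (χ : Fin m → ℤ) (hχ : χ ≠ 0) :
    AddMonoidAlgebra.single χ (1 : R) - 1 ∈ (AddMonoidAlgebra R (Fin m → ℤ))⁰ := by
  classical
  rw [mem_nonZeroDivisors_iff_right]
  intro g hg
  -- `g.coeff (x + χ) = g.coeff x` for every `x`
  have hshift : ∀ x : Fin m → ℤ, g.coeff (x + χ) = g.coeff x := by
    intro x
    have h1 : (g * (AddMonoidAlgebra.single χ (1 : R) - 1)).coeff (x + χ) = 0 := by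
      rw [hg]; rfl
    rw [mul_sub, mul_one, AddMonoidAlgebra.coeff_sub, Finsupp.sub_apply,
      AddMonoidAlgebra.coeff_mul_single_add, mul_one, sub_eq_zero] at h1
    exact h1.symm
  -- the linear form `φ x = ∑ χᵢ xᵢ` increases strictly along `x ↦ x + χ`
  let φ : (Fin m → ℤ) → ℤ := fun x => ∑ i, χ i * x i
  have hφ : ∀ x, φ x < φ (x + χ) := by
    intro x
    simp only [φ, Pi.add_apply, mul_add, Finset.sum_add_distrib, lt_add_iff_pos_right]
    have hpos : ∀ i, 0 ≤ χ i * χ i := fun i => mul_self_nonneg (χ i)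
    obtain ⟨i, hi⟩ : ∃ i, χ i ≠ 0 := by
      by_contra h
      push Not at h
      exact hχ (funext h)
    exact Finset.sum_pos' (fun i _ => hpos i) ⟨i, Finset.mem_univ i, mul_self_pos.mpr hi⟩
  by_contra hg0
  have hne : g.coeff.support.Nonempty := by
    rw [Finsupp.support_nonempty_iff]
    intro h
    exact hg0 (AddMonoidAlgebra.coeff_injective (by rw [h]; rfl))
  obtain ⟨x, hx, hmax⟩ := Finset.exists_max_image g.coeff.support φ hne
  have hx' : x + χ ∈ g.coeff.support := by
    rw [Finsupp.mem_support_iff] at hx ⊢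
    rwa [hshift]
  exact (lt_irrefl _) ((hφ x).trans_le (hmax _ hx'))

/-- One more Laurent variable raises the Krull dimension: `dim R[ℤᵐ] + 1 ≤ dim R[ℤᵐ⁺¹]` (the substitution
`T_last ↦ 1`, i.e. `mapDomain` along the projection `ℤᵐ⁺¹ → ℤᵐ`, is surjective and kills the
non-zero-divisor `T_last - 1`; `ringKrullDim_succ_le_of_surjective`). [folklore] -/
theorem ringKrullDim_laurent_succ_le (m : ℕ) :
    ringKrullDim (AddMonoidAlgebra R (Fin m → ℤ)) + 1 ≤
      ringKrullDim (AddMonoidAlgebra R (Fin (m + 1) → ℤ)) := by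
  classical
  let π : (Fin (m + 1) → ℤ) →+ (Fin m → ℤ) := (LinearMap.funLeft ℤ ℤ Fin.castSucc).toAddMonoidHom
  have hπ : Function.Surjective π :=
    LinearMap.funLeft_surjective_of_injective ℤ ℤ _ (Fin.castSucc_injective m)
  let f := AddMonoidAlgebra.mapDomainRingHom R π
  have hf : Function.Surjective f := fun y => by
    induction y using AddMonoidAlgebra.induction_linear with
    | zero => exact ⟨0, map_zero f⟩
    | add a b ha hb =>
      obtain ⟨a', rfl⟩ := ha
      obtain ⟨b', rfl⟩ := hb
      exact ⟨a' + b', map_add f a' b'⟩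
    | single n r =>
      obtain ⟨n', rfl⟩ := hπ n
      exact ⟨AddMonoidAlgebra.single n' r, by simp [f]⟩
  let χ : Fin (m + 1) → ℤ := Pi.single (Fin.last m) 1
  have hχ : χ ≠ 0 := by
    intro h
    have := congr_fun h (Fin.last m)
    simp [χ] at this
  have hπχ : π χ = 0 := by
    ext i
    simp [π, LinearMap.funLeft_apply, χ, Fin.castSucc_ne_last]
  refine ringKrullDim_succ_le_of_surjective f hf
    (laurent_single_sub_one_mem_nonZeroDivisors R χ hχ) ?_
  rw [map_sub, map_one, sub_eq_zero]
  show AddMonoidAlgebra.mapDomain π (AddMonoidAlgebra.single χ 1) = 1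
  rw [AddMonoidAlgebra.mapDomain_single, hπχ, AddMonoidAlgebra.one_def]

/-- **Krull dimension of Laurent polynomial rings**: `dim R + m ≤ dim R[T₁^{±1}, …, T_m^{±1}]` for every
commutative ring `R` (`R[ℤᵐ] = AddMonoidAlgebra R (Fin m → ℤ)`; induction on `m`, base `R[ℤ⁰] ≃ R`).
[folklore] -/
theorem ringKrullDim_add_le_ringKrullDim_laurent (m : ℕ) :
    ringKrullDim R + m ≤ ringKrullDim (AddMonoidAlgebra R (Fin m → ℤ)) := by
  induction m with
  | zero =>
    simp only [Nat.cast_zero, add_zero]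
    exact (ringKrullDim_eq_of_ringEquiv
      (AddMonoidAlgebra.uniqueRingEquiv (R := R) (M := Fin 0 → ℤ))).symm.le
  | succ m ih =>
    calc ringKrullDim R + ((m + 1 : ℕ) : WithBot ℕ∞)
        = (ringKrullDim R + m) + 1 := by push_cast; rw [add_assoc]
      _ ≤ ringKrullDim (AddMonoidAlgebra R (Fin m → ℤ)) + 1 := by gcongr
      _ ≤ _ := ringKrullDim_laurent_succ_le R m

end Laurent

end Summit.ResolutionOfSingularities.ResolutionOfSingularities.Theorems

end
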